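import Mathlib
import HarnessLib

/-!
# Uniform symbol estimates for families of amplitudes on a half-line

Bookkeeping for non-stationary-phase arguments (Stein, *Harmonic Analysis* (1993), Ch. VIII
§1; Hörmander, *The Analysis of Linear Partial Differential Operators I*, §7.7): a family of
real amplitudes `a i : ℝ → ℝ` (`i` in an index set `S`) is a *uniform symbol of order `n` up to
`R` derivatives on `(H, ∞)`* (`SymBnd S H n R a`) when
`|a_i^{(r)}(τ)| ≤ C_r τ^{n-r} (log (τ+2))^{p_r}` for `τ > H`, `r ≤ R`, with constants independent of
`i ∈ S`. We prove the calculus: monotonicity, products (Leibniz), derivatives, bounded scalar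
multiples, sums, inverses of uniformly positive order-`0` symbols and powers `τ^l` (the smooth
cut-offs are in `ChirpCutoffs.lean`). Everything is elementary and proved; no definitions beyond
the two predicates, no named facts.
-/

noncomputable section

open Set Filter
open scoped Topology ContDiff

namespace Literature.Analysis.Fourier

variable {ι : Type*}

/-- `SymBnd S H n R a`: for every `r ≤ R` there are `C ≥ 0` and `p : ℕ` with
`|a_i^{(r)}(τ)| ≤ C τ^{n-r} (log(τ+2))^p` for all `i ∈ S` and all `τ > H` (uniform symbol bounds
of order `n`, Hörmander's class `S^n` with logarithmic losses, uniformly in the family).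
[folklore] -/
def SymBnd (S : Set ι) (H n : ℝ) (R : ℕ) (a : ι → ℝ → ℝ) : Prop :=
  ∀ r : ℕ, r ≤ R → ∃ C : ℝ, 0 ≤ C ∧ ∃ p : ℕ, ∀ i ∈ S, ∀ τ : ℝ, H < τ →
    |iteratedDeriv r (a i) τ| ≤ C * τ ^ (n - r) * Real.log (τ + 2) ^ p

/-- `SmoothFam S H a`: every member `a i`, `i ∈ S`, is `C^∞` on the open half-line `(H, ∞)`.
[folklore] -/
def SmoothFam (S : Set ι) (H : ℝ) (a : ι → ℝ → ℝ) : Prop :=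
  ∀ i ∈ S, ContDiffOn ℝ ∞ (a i) (Ioi H)

/-- `log (τ + 2) ≥ 1` for `τ ≥ 1` (since `e < 3`). [folklore] -/
theorem one_le_log_add_two {τ : ℝ} (hτ : 1 ≤ τ) : 1 ≤ Real.log (τ + 2) := by
  rw [Real.le_log_iff_exp_le (by linarith)]
  have := Real.exp_one_lt_d9
  linarith

/-- Exponent bookkeeping `τ^{n-l} τ^{n'-(r-l)} = τ^{n+n'-r}` for `l ≤ r`. [folklore] -/
theorem rpow_mul_rpow_sub_natCast {τ : ℝ} (hτ : 0 < τ) (n n' : ℝ) {l r : ℕ} (hl : l ≤ r) :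
    τ ^ (n - l) * τ ^ (n' - ((r - l : ℕ) : ℝ)) = τ ^ (n + n' - r) := by
  rw [← Real.rpow_add hτ, Nat.cast_sub hl]
  congr 1
  ring

namespace SymBnd

variable {S : Set ι} {H n n' : ℝ} {R : ℕ} {a b : ι → ℝ → ℝ}

/-- Fewer derivatives. [folklore] -/
theorem mono_R (h : SymBnd S H n R a) {R' : ℕ} (hR : R' ≤ R) : SymBnd S H n R' a :=
  fun r hr => h r (hr.trans hR)

/-- Smaller index set. [folklore] -/
theorem mono_set (h : SymBnd S H n R a) {S' : Set ι} (hS : S' ⊆ S) : SymBnd S' H n R a := by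
  intro r hr
  obtain ⟨C, hC, p, hb⟩ := h r hr
  exact ⟨C, hC, p, fun i hi τ hτ => hb i (hS hi) τ hτ⟩

/-- Re-indexing along a map sending `S'` into `S`. [folklore] -/
theorem comp {ι' : Type*} (h : SymBnd S H n R a) {S' : Set ι'} (f : ι' → ι)
    (hf : MapsTo f S' S) : SymBnd S' H n R (fun i => a (f i)) := by
  intro r hr
  obtain ⟨C, hC, p, hb⟩ := h r hr
  exact ⟨C, hC, p, fun i hi τ hτ => hb (f i) (hf hi) τ hτ⟩

/-- Larger order (on `τ > H ≥ 1`). [folklore] -/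
theorem mono_order (hH : 1 ≤ H) (h : SymBnd S H n R a) (hn : n ≤ n') : SymBnd S H n' R a := by
  intro r hr
  obtain ⟨C, hC, p, hb⟩ := h r hr
  refine ⟨C, hC, p, fun i hi τ hτ => (hb i hi τ hτ).trans ?_⟩
  have hτ1 : 1 ≤ τ := hH.trans hτ.le
  have hlog : 0 ≤ Real.log (τ + 2) := by linarith [one_le_log_add_two hτ1]
  apply mul_le_mul_of_nonneg_right _ (pow_nonneg hlog p)
  exact mul_le_mul_of_nonneg_left (Real.rpow_le_rpow_of_exponent_le hτ1 (by linarith)) hC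

/-- **Leibniz**: the product of uniform symbols of orders `n`, `n'` is a uniform symbol of order
`n + n'`. [folklore] -/
theorem mul (hH : 1 ≤ H) (ha : SmoothFam S H a) (hb : SmoothFam S H b)
    (hsa : SymBnd S H n R a) (hsb : SymBnd S H n' R b) :
    SymBnd S H (n + n') R (fun i τ => a i τ * b i τ) := by
  choose! C hC p hp using hsa
  choose! C' hC' p' hp' using hsb
  intro r hr
  refine ⟨∑ l ∈ Finset.range (r + 1), (r.choose l : ℝ) * C l * C' (r - l), ?_,
    (∑ l ∈ Finset.range (r + 1), p l) + ∑ l ∈ Finset.range (r + 1), p' l, ?_⟩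
  · refine Finset.sum_nonneg fun l hl => ?_
    have hlr : l ≤ r := Nat.lt_succ_iff.mp (Finset.mem_range.mp hl)
    have h1 := hC l (hlr.trans hr)
    have h2 := hC' (r - l) ((Nat.sub_le r l).trans hr)
    positivity
  · intro i hi τ hτ
    have hτ0 : 0 < τ := by linarith
    have hτ1 : 1 ≤ τ := hH.trans hτ.le
    set ℓ := Real.log (τ + 2) with hℓ
    have hℓ1 : 1 ≤ ℓ := one_le_log_add_two hτ1
    have hℓ0 : 0 ≤ ℓ := by linarith
    set P := (∑ l ∈ Finset.range (r + 1), p l) + ∑ l ∈ Finset.range (r + 1), p' l with hP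
    have hcda : ContDiffAt ℝ r (a i) τ :=
      ((ha i hi).contDiffAt (Ioi_mem_nhds hτ)).of_le (mod_cast le_top)
    have hcdb : ContDiffAt ℝ r (b i) τ :=
      ((hb i hi).contDiffAt (Ioi_mem_nhds hτ)).of_le (mod_cast le_top)
    rw [iteratedDeriv_fun_mul hcda hcdb]
    calc |∑ l ∈ Finset.range (r + 1),
            (r.choose l : ℝ) * iteratedDeriv l (a i) τ * iteratedDeriv (r - l) (b i) τ|
        ≤ ∑ l ∈ Finset.range (r + 1),
            |(r.choose l : ℝ) * iteratedDeriv l (a i) τ * iteratedDeriv (r - l) (b i) τ| :=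
          Finset.abs_sum_le_sum_abs _ _
      _ ≤ ∑ l ∈ Finset.range (r + 1),
            (r.choose l : ℝ) * C l * C' (r - l) * (τ ^ (n + n' - r) * ℓ ^ P) := by
          refine Finset.sum_le_sum fun l hl => ?_
          have hlr : l ≤ r := Nat.lt_succ_iff.mp (Finset.mem_range.mp hl)
          have hrl : r - l ∈ Finset.range (r + 1) := Finset.mem_range.mpr (Nat.sub_lt_succ r l)
          have h1 := hp l (hlr.trans hr) i hi τ hτ
          have h2 := hp' (r - l) ((Nat.sub_le r l).trans hr) i hi τ hτ
          have hB1 : 0 ≤ C l * τ ^ (n - l) * ℓ ^ p l :=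
            mul_nonneg (mul_nonneg (hC l (hlr.trans hr)) (Real.rpow_nonneg hτ0.le _))
              (pow_nonneg hℓ0 _)
          rw [abs_mul, abs_mul, Nat.abs_cast]
          have hpp : p l + p' (r - l) ≤ P := by
            have e1 : p l ≤ ∑ l ∈ Finset.range (r + 1), p l :=
              Finset.single_le_sum (fun _ _ => Nat.zero_le _) hl
            have e2 : p' (r - l) ≤ ∑ l ∈ Finset.range (r + 1), p' l :=
              Finset.single_le_sum (fun _ _ => Nat.zero_le _) hrl
            omega
          calc (r.choose l : ℝ) * |iteratedDeriv l (a i) τ| * |iteratedDeriv (r - l) (b i) τ|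
              ≤ (r.choose l : ℝ) * (C l * τ ^ (n - l) * ℓ ^ p l) *
                  (C' (r - l) * τ ^ (n' - ((r - l : ℕ) : ℝ)) * ℓ ^ p' (r - l)) :=
                mul_le_mul (mul_le_mul_of_nonneg_left h1 (by positivity)) h2 (abs_nonneg _)
                  (mul_nonneg (by positivity) hB1)
            _ = (r.choose l : ℝ) * C l * C' (r - l) *
                  ((τ ^ (n - l) * τ ^ (n' - ((r - l : ℕ) : ℝ))) * ℓ ^ (p l + p' (r - l))) := by
                rw [pow_add]; ring
            _ ≤ (r.choose l : ℝ) * C l * C' (r - l) * (τ ^ (n + n' - r) * ℓ ^ P) := by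
                rw [rpow_mul_rpow_sub_natCast hτ0 n n' hlr]
                have h3 : 0 ≤ (r.choose l : ℝ) * C l * C' (r - l) := by
                  have := hC l (hlr.trans hr)
                  have := hC' (r - l) ((Nat.sub_le r l).trans hr)
                  positivity
                refine mul_le_mul_of_nonneg_left ?_ h3
                exact mul_le_mul_of_nonneg_left (pow_le_pow_right₀ hℓ1 hpp)
                  (Real.rpow_nonneg hτ0.le _)
      _ = (∑ l ∈ Finset.range (r + 1), (r.choose l : ℝ) * C l * C' (r - l)) *
            τ ^ (n + n' - r) * ℓ ^ P := by
          rw [Finset.sum_mul, Finset.sum_mul]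
          exact Finset.sum_congr rfl fun l _ => by ring

/-- The derivative of a uniform symbol of order `n` (with one more derivative controlled) is a
uniform symbol of order `n - 1`. [folklore] -/
theorem deriv (h : SymBnd S H n (R + 1) a) :
    SymBnd S H (n - 1) R (fun i => _root_.deriv (a i)) := by
  intro r hr
  obtain ⟨C, hC, p, hb⟩ := h (r + 1) (by omega)
  refine ⟨C, hC, p, fun i hi τ hτ => ?_⟩
  have := hb i hi τ hτ
  rw [iteratedDeriv_succ'] at this
  convert this using 3
  push_cast
  ring

/-- Bounded scalar multiples. [folklore] -/
theorem const_mul (h : SymBnd S H n R a) (c : ι → ℝ) {M : ℝ} (hM : 0 ≤ M)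
    (hc : ∀ i ∈ S, |c i| ≤ M) : SymBnd S H n R (fun i τ => c i * a i τ) := by
  intro r hr
  obtain ⟨C, hC, p, hb⟩ := h r hr
  refine ⟨M * C, mul_nonneg hM hC, p, fun i hi τ hτ => ?_⟩
  rw [iteratedDeriv_const_mul_field, abs_mul]
  have h1 := hb i hi τ hτ
  have h2 := hc i hi
  have h3 : 0 ≤ C * τ ^ (n - r) * Real.log (τ + 2) ^ p := le_trans (abs_nonneg _) h1
  calc |c i| * |iteratedDeriv r (a i) τ| ≤ M * (C * τ ^ (n - r) * Real.log (τ + 2) ^ p) :=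
        mul_le_mul h2 h1 (abs_nonneg _) hM
    _ = M * C * τ ^ (n - r) * Real.log (τ + 2) ^ p := by ring

/-- Negation. [folklore] -/
theorem neg (h : SymBnd S H n R a) : SymBnd S H n R (fun i τ => -a i τ) := by
  have := h.const_mul (fun _ => (-1 : ℝ)) zero_le_one (fun i _ => by norm_num)
  simpa using this

/-- Sums (same order). [folklore] -/
theorem add (hH : 1 ≤ H) (ha : SmoothFam S H a) (hb : SmoothFam S H b)
    (hsa : SymBnd S H n R a) (hsb : SymBnd S H n R b) :
    SymBnd S H n R (fun i τ => a i τ + b i τ) := by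
  intro r hr
  obtain ⟨C, hC, p, h1⟩ := hsa r hr
  obtain ⟨C', hC', p', h2⟩ := hsb r hr
  refine ⟨C + C', add_nonneg hC hC', p + p', fun i hi τ hτ => ?_⟩
  have hτ0 : 0 < τ := by linarith
  have hτ1 : 1 ≤ τ := hH.trans hτ.le
  have hℓ1 : 1 ≤ Real.log (τ + 2) := one_le_log_add_two hτ1
  have hcda : ContDiffAt ℝ r (a i) τ :=
    ((ha i hi).contDiffAt (Ioi_mem_nhds hτ)).of_le (mod_cast le_top)
  have hcdb : ContDiffAt ℝ r (b i) τ :=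
    ((hb i hi).contDiffAt (Ioi_mem_nhds hτ)).of_le (mod_cast le_top)
  rw [iteratedDeriv_fun_add hcda hcdb]
  have e1 := h1 i hi τ hτ
  have e2 := h2 i hi τ hτ
  have hp1 : Real.log (τ + 2) ^ p ≤ Real.log (τ + 2) ^ (p + p') :=
    pow_le_pow_right₀ hℓ1 (by omega)
  have hp2 : Real.log (τ + 2) ^ p' ≤ Real.log (τ + 2) ^ (p + p') :=
    pow_le_pow_right₀ hℓ1 (by omega)
  have hτn : 0 ≤ τ ^ (n - r) := Real.rpow_nonneg hτ0.le _
  calc |iteratedDeriv r (a i) τ + iteratedDeriv r (b i) τ|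
      ≤ |iteratedDeriv r (a i) τ| + |iteratedDeriv r (b i) τ| := abs_add_le _ _
    _ ≤ C * τ ^ (n - r) * Real.log (τ + 2) ^ p + C' * τ ^ (n - r) * Real.log (τ + 2) ^ p' :=
        add_le_add e1 e2
    _ ≤ C * τ ^ (n - r) * Real.log (τ + 2) ^ (p + p') +
          C' * τ ^ (n - r) * Real.log (τ + 2) ^ (p + p') :=
        add_le_add (mul_le_mul_of_nonneg_left hp1 (mul_nonneg hC hτn))
          (mul_le_mul_of_nonneg_left hp2 (mul_nonneg hC' hτn))
    _ = (C + C') * τ ^ (n - r) * Real.log (τ + 2) ^ (p + p') := by ring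

/-- Transfer along equality on `(H, ∞)`. [folklore] -/
theorem congr (h : SymBnd S H n R a) (hab : ∀ i ∈ S, EqOn (a i) (b i) (Ioi H)) :
    SymBnd S H n R b := by
  intro r hr
  obtain ⟨C, hC, p, hb⟩ := h r hr
  refine ⟨C, hC, p, fun i hi τ hτ => ?_⟩
  rw [← (hab i hi).iteratedDeriv_of_isOpen isOpen_Ioi r hτ]
  exact hb i hi τ hτ

end SymBnd

namespace SmoothFam

variable {S : Set ι} {H : ℝ} {a b : ι → ℝ → ℝ}

/-- Products of smooth families. [folklore] -/
theorem mul (ha : SmoothFam S H a) (hb : SmoothFam S H b) :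
    SmoothFam S H (fun i τ => a i τ * b i τ) := fun i hi => (ha i hi).mul (hb i hi)

/-- Sums of smooth families. [folklore] -/
theorem add (ha : SmoothFam S H a) (hb : SmoothFam S H b) :
    SmoothFam S H (fun i τ => a i τ + b i τ) := fun i hi => (ha i hi).add (hb i hi)

/-- Derivatives of smooth families. [folklore] -/
theorem deriv (ha : SmoothFam S H a) : SmoothFam S H (fun i => _root_.deriv (a i)) :=
  fun i hi => ((contDiffOn_infty_iff_deriv_of_isOpen isOpen_Ioi).1 (ha i hi)).2

/-- Scalar multiples of smooth families. [folklore] -/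
theorem const_mul (ha : SmoothFam S H a) (c : ι → ℝ) :
    SmoothFam S H (fun i τ => c i * a i τ) := fun i hi => contDiffOn_const.mul (ha i hi)

/-- Inverses of non-vanishing smooth families. [folklore] -/
theorem inv (ha : SmoothFam S H a) (h0 : ∀ i ∈ S, ∀ τ, H < τ → a i τ ≠ 0) :
    SmoothFam S H (fun i τ => (a i τ)⁻¹) := fun i hi => (ha i hi).inv (fun τ hτ => h0 i hi τ hτ)

/-- Transfer along equality on `(H, ∞)`. [folklore] -/
theorem congr (ha : SmoothFam S H a) (hab : ∀ i ∈ S, EqOn (a i) (b i) (Ioi H)) :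
    SmoothFam S H b := fun i hi => (ha i hi).congr (fun _ hτ => (hab i hi hτ).symm)

end SmoothFam

/-! ## Inverses -/

/-- **Inverse of a uniformly positive order-`0` symbol.** If `d` is a smooth family on `(H, ∞)`
with uniform symbol bounds of order `0` to all orders and `d_i(τ) ≥ μ > 0`, then `1/d` has uniform
symbol bounds of order `0` to all orders (induction on the order via `(1/d)' = -d' (1/d)²`).
[folklore] -/
theorem SymBnd.inv {S : Set ι} {H μ : ℝ} {d : ι → ℝ → ℝ} (hH : 1 ≤ H) (hd : SmoothFam S H d)
    (hsd : ∀ R, SymBnd S H 0 R d) (hμ : 0 < μ) (hpos : ∀ i ∈ S, ∀ τ, H < τ → μ ≤ d i τ) :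
    ∀ R, SymBnd S H 0 R (fun i τ => (d i τ)⁻¹) := by
  have h0 : ∀ i ∈ S, ∀ τ, H < τ → d i τ ≠ 0 := fun i hi τ hτ => (hμ.trans_le (hpos i hi τ hτ)).ne'
  have hv : SmoothFam S H (fun i τ => (d i τ)⁻¹) := hd.inv h0
  -- the derivative of the inverse on `(H, ∞)`
  have hder : ∀ i ∈ S, EqOn (fun τ => -_root_.deriv (d i) τ * (d i τ)⁻¹ * (d i τ)⁻¹)
      (_root_.deriv (fun τ => (d i τ)⁻¹)) (Ioi H) := by
    intro i hi τ hτ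
    have hdd : DifferentiableAt ℝ (d i) τ :=
      ((hd i hi).differentiableOn (by simp)).differentiableAt (Ioi_mem_nhds hτ)
    have := (hdd.hasDerivAt.inv (h0 i hi τ hτ)).deriv
    rw [show (fun τ => (d i τ)⁻¹) = (d i)⁻¹ from rfl, this]
    field_simp
  intro R
  induction R with
  | zero =>
    intro r hr
    obtain rfl : r = 0 := Nat.le_zero.mp hr
    refine ⟨μ⁻¹, inv_nonneg.mpr hμ.le, 0, fun i hi τ hτ => ?_⟩
    have h1 := hpos i hi τ hτ
    have h2 : 0 < d i τ := hμ.trans_le h1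
    rw [iteratedDeriv_zero, pow_zero, mul_one, Nat.cast_zero, sub_zero, Real.rpow_zero, mul_one,
      abs_of_pos (inv_pos.mpr h2)]
    exact inv_anti₀ hμ h1
  | succ R ih =>
    intro r hr
    rcases Nat.lt_or_ge r (R + 1) with hlt | hge
    · exact ih r (Nat.lt_succ_iff.mp hlt)
    · obtain rfl : r = R + 1 := le_antisymm hr hge
      -- `g = -d' v v` is a uniform symbol of order `-1` up to `R` derivatives
      have hg : SymBnd S H (-1 + 0 + 0) R
          (fun i τ => -_root_.deriv (d i) τ * (d i τ)⁻¹ * (d i τ)⁻¹) := by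
        refine SymBnd.mul hH ((hd.deriv.const_mul (fun _ => (-1 : ℝ))).congr ?_ |>.mul hv) hv
          (SymBnd.mul hH ((hd.deriv.const_mul (fun _ => (-1 : ℝ))).congr ?_) hv ?_ ih) ih
        · intro i hi τ hτ; simp
        · intro i hi τ hτ; simp
        · have := ((hsd (R + 1)).deriv).neg
          simpa using this
      obtain ⟨C, hC, p, hb⟩ := hg R le_rfl
      refine ⟨C, hC, p, fun i hi τ hτ => ?_⟩
      rw [iteratedDeriv_succ', ← (hder i hi).iteratedDeriv_of_isOpen isOpen_Ioi R hτ]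
      have := hb i hi τ hτ
      convert this using 3
      push_cast
      ring

/-! ## Powers of `τ` -/

/-- `τ ↦ τ^l` is a (constant) uniform symbol family of order `l`. [folklore] -/
theorem SymBnd.pow (S : Set ι) {H : ℝ} (hH : 1 ≤ H) (l : ℕ) (R : ℕ) :
    SymBnd S H l R (fun _ τ => τ ^ l) := by
  intro r hr
  refine ⟨l.descFactorial r, by positivity, 0, fun i hi τ hτ => ?_⟩
  have hτ0 : 0 < τ := by linarith
  rw [iteratedDeriv_pow, pow_zero, mul_one, abs_mul, Nat.abs_cast, abs_of_pos (pow_pos hτ0 _)]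
  rcases le_or_gt r l with h | h
  · rw [← Nat.cast_sub h, Real.rpow_natCast]
  · rw [Nat.descFactorial_eq_zero_iff_lt.mpr h]
    simp

/-- `τ ↦ τ^l` is smooth. [folklore] -/
theorem SmoothFam.pow (S : Set ι) (H : ℝ) (l : ℕ) : SmoothFam S H (fun _ τ => τ ^ l) :=
  fun _ _ => (contDiff_id.pow l).contDiffOn

end Literature.Analysis.Fourier
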